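import Literature.NumberTheory.Transcendental.QuadraticRelationsLogarithmsSec4Heights
import Mathlib.LinearAlgebra.FreeModule.PID
import Mathlib.LinearAlgebra.Matrix.NonsingularInverse
import Mathlib.LinearAlgebra.Matrix.Nondegenerate
import Mathlib.LinearAlgebra.Dimension.OrzechProperty
import HarnessLib

/-!
# Roy–Waldschmidt 1997, §4: reduction of subspaces at a place, regular bases (Lemmes 4.3, 4.4)

D. Roy, M. Waldschmidt, *Approximation diophantienne et indépendance algébrique de logarithmes*,
Ann. Sci. ÉNS (4) 30 (1997) 753–796, §4, pp. 773–774.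

Fix a place `𝔭` of the function field `K/k` (`p : PlaceOver k K` of the tree's library
`Literature.NumberTheory.DiophantineGeometry.AlgFunctionField`), with valuation ring `𝒪 = 𝒪_𝔭`
(a discrete valuation ring), residue field `κ = κ(𝔭)` and reduction `r : 𝒪 → κ`, `x ↦ x̄`,
extended coordinatewise to `𝒪ⁿ → κⁿ` (p. 773: "pour tout `x ∈ 𝒪` on désigne par `x̄` l'image de
`x` sous `r` … on étend cette définition aux points `x = (x₁, …, xₙ)` de `𝒪ⁿ` en posant
`x̄ = (x̄₁, …, x̄ₙ)`. Enfin, si `V` est un sous-espace de `Kⁿ`, on désigne par `V̄` le sous-espace de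
`κⁿ` constitué des points `x̄` avec `x ∈ V ∩ 𝒪ⁿ`").

> **Lemme 4.3.** Soit `V` un sous-espace de `Kⁿ` et soient `x₁, …, x_m` des éléments de
> `V ∩ 𝒪ⁿ`. Alors on a `dim_κ(V̄) = dim_K(V)` et les trois conditions suivantes sont équivalentes :
> (i) `{x₁, …, x_m}` est à la fois une base de `V ∩ 𝒪ⁿ` en tant que module sur `𝒪` et une base de
> `V` en tant qu'espace vectoriel sur `K`; (ii) `{x̄₁, …, x̄_m}` est une base de `V̄`;
> (iii) `m = dim_K(V)` et `ord_𝔭(x₁ ∧ ⋯ ∧ x_m) = 0`.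
>
> Une base de `V` contenue dans `𝒪ⁿ` remplissant ces conditions est dite *régulière* (en `𝔭`).
>
> **Lemme 4.4.** Si `x₁, …, x_k ∈ V ∩ 𝒪ⁿ` ont des images `x̄₁, …, x̄_k` linéairement indépendantes
> sur `κ`, on peut compléter `{x₁, …, x_k}` en une base régulière de `V`.

This file formalizes: `redVec` (coordinatewise reduction), `integralPoints p V = V ∩ 𝒪ⁿ`,
`reduction p V = V̄`, the structure theorem behind Lemme 4.3 (`exists_adapted_basis`: `V ∩ 𝒪ⁿ` is
spanned by part of an `𝒪`-basis of `𝒪ⁿ` — "puisque `𝒪` est un anneau principal … `V ∩ 𝒪ⁿ` est un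
`𝒪`-module libre de rang `dim_K V`", here via Mathlib's Smith normal form and the saturation of
`V ∩ 𝒪ⁿ` in `𝒪ⁿ`), **`finrank_reduction`** (`dim_κ V̄ = dim_K V`), the predicate `IsRegularBasis`
(condition (ii)), the implications (ii) ⇒ (i) (`IsRegularBasis.linearIndependent_int`,
`.span_int_eq`, `.linearIndependent`, `.span_eq`), (i) ⇒ (ii) (`isRegularBasis_of_basis_int`),
(ii) ⇔ (iii) (`IsRegularBasis.ordVec_minors_eq_zero`, `isRegularBasis_of_ordVec_minors_eq_zero`,
with the exterior product `x₁ ∧ ⋯ ∧ x_m` realised by its Plücker coordinates `minors x`, the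
`m × m` minors of the matrix with rows `xᵢ`), and **Lemme 4.4** (`lemme_4_4`).

Everything is proved; no named facts are introduced.

## References

* [RoyWaldschmidt1997ENS] D. Roy, M. Waldschmidt, Ann. Sci. ÉNS (4) 30 (1997) 753–796, §4,
  Lemme 4.3 and Lemme 4.4, pp. 773–774.
-/

noncomputable section

open scoped Classical

namespace Literature.NumberTheory.Transcendental

namespace RoyWaldschmidt1997

open Literature.NumberTheory.DiophantineGeometry
open Literature.NumberTheory.DiophantineGeometry.AlgFunctionField

universe u v

variable {k : Type u} {K : Type v} [Field k] [Field K] [Algebra k K]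

open Module Submodule

variable (p : PlaceOver k K)
variable {n : Type*}

/-! ### Reduction of integral vectors -/

/-- Coordinatewise reduction `𝒪ⁿ → κⁿ`, `x ↦ x̄ = (x̄₁, …, x̄ₙ)`.
[cite: RoyWaldschmidt1997ENS, §4, p. 773] -/
def redVec (x : n → p.toValuationSubring) : n → p.residueField :=
  fun i ↦ IsLocalRing.residue p.toValuationSubring (x i)

/-- Coordinates of the reduction. [cite: RoyWaldschmidt1997ENS, §4, p. 773] -/
@[simp]
theorem redVec_apply (x : n → p.toValuationSubring) (i : n) :
    redVec p x i = IsLocalRing.residue p.toValuationSubring (x i) := rfl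

/-- `0̄ = 0`. [folklore] -/
@[simp]
theorem redVec_zero : redVec p (0 : n → p.toValuationSubring) = 0 := by
  ext i; simp [redVec]

/-- Reduction is additive. [folklore] -/
theorem redVec_add (x y : n → p.toValuationSubring) : redVec p (x + y) = redVec p x + redVec p y := by
  ext i; simp [redVec]

/-- Reduction is semilinear: `(c x)‾ = c̄ x̄`. [folklore] -/
theorem redVec_smul (c : p.toValuationSubring) (x : n → p.toValuationSubring) :
    redVec p (c • x) = IsLocalRing.residue p.toValuationSubring c • redVec p x := by
  ext i; simp [redVec]

/-- Coordinatewise reduction as a semilinear map over `r : 𝒪 → κ`. [cite: RoyWaldschmidt1997ENS, §4, p. 773] -/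
def redVecₛₗ : (n → p.toValuationSubring) →ₛₗ[IsLocalRing.residue p.toValuationSubring]
    (n → p.residueField) where
  toFun := redVec p
  map_add' := redVec_add p
  map_smul' := redVec_smul p

/-- Unfolding of the semilinear reduction map. [folklore] -/
@[simp]
theorem redVecₛₗ_apply (x : n → p.toValuationSubring) : redVecₛₗ p x = redVec p x := rfl

/-- Every vector of `κⁿ` lifts to `𝒪ⁿ`. [folklore] -/
theorem redVec_surjective : Function.Surjective (redVec p (n := n)) := by
  intro y
  choose x hx using fun i ↦ IsLocalRing.residue_surjective (y i)
  exact ⟨x, funext hx⟩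

/-- Reduction of a finite sum. [folklore] -/
theorem redVec_sum {ι : Type*} (s : Finset ι) (x : ι → n → p.toValuationSubring) :
    redVec p (∑ i ∈ s, x i) = ∑ i ∈ s, redVec p (x i) :=
  map_sum (redVecₛₗ p) x s

/-! ### Integral points of a subspace and the reduced subspace `V̄` -/

/-- The inclusion `𝒪ⁿ → Kⁿ`. [folklore] -/
def inclVec (x : n → p.toValuationSubring) : n → K := fun i ↦ (x i : K)

/-- Coordinates of the inclusion `𝒪ⁿ → Kⁿ`. [folklore] -/
@[simp]
theorem inclVec_apply (x : n → p.toValuationSubring) (i : n) : inclVec p x i = (x i : K) := rfl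

/-- The inclusion `𝒪ⁿ → Kⁿ` is injective. [folklore] -/
theorem inclVec_injective : Function.Injective (inclVec p (n := n)) := by
  intro x y h
  ext i
  exact congr_fun h i

/-- The inclusion `𝒪ⁿ → Kⁿ` as an `𝒪`-linear map. [folklore] -/
def inclVecₗ : (n → p.toValuationSubring) →ₗ[p.toValuationSubring] (n → K) where
  toFun := inclVec p
  map_add' x y := by ext i; simp [inclVec]
  map_smul' c x := by ext i; simp [inclVec, Algebra.smul_def]

/-- Unfolding of the linear inclusion map. [folklore] -/
@[simp]
theorem inclVecₗ_apply (x : n → p.toValuationSubring) : inclVecₗ p x = inclVec p x := rfl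

/-- The inclusion maps `0` to `0`. [folklore] -/
@[simp]
theorem inclVec_zero : inclVec p (0 : n → p.toValuationSubring) = 0 := by ext; simp [inclVec]

/-- The inclusion is additive. [folklore] -/
theorem inclVec_add (x y : n → p.toValuationSubring) : inclVec p (x + y) = inclVec p x + inclVec p y :=
  map_add (inclVecₗ p) x y

/-- The inclusion is `𝒪`-linear: `(c x) ↦ c x`. [folklore] -/
theorem inclVec_smul (c : p.toValuationSubring) (x : n → p.toValuationSubring) :
    inclVec p (c • x) = (c : K) • inclVec p x := by
  ext i; simp [inclVec]

/-- Inclusion of a finite sum. [folklore] -/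
theorem inclVec_sum {ι : Type*} (s : Finset ι) (x : ι → n → p.toValuationSubring) :
    inclVec p (∑ i ∈ s, x i) = ∑ i ∈ s, inclVec p (x i) :=
  map_sum (inclVecₗ p) x s

/-- An integral vector is `0` in `Kⁿ` iff it is `0`. [folklore] -/
theorem inclVec_eq_zero_iff {x : n → p.toValuationSubring} : inclVec p x = 0 ↔ x = 0 := by
  rw [← inclVec_zero p]
  exact (inclVec_injective p).eq_iff

/-- **`V ∩ 𝒪ⁿ`** as an `𝒪`-submodule of `𝒪ⁿ`. [cite: RoyWaldschmidt1997ENS, §4, p. 773] -/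
def integralPoints (V : Submodule K (n → K)) :
    Submodule p.toValuationSubring (n → p.toValuationSubring) :=
  (V.restrictScalars p.toValuationSubring).comap (inclVecₗ p)

/-- Membership in `V ∩ 𝒪ⁿ`. [cite: RoyWaldschmidt1997ENS, §4, p. 773] -/
theorem mem_integralPoints {V : Submodule K (n → K)} {x : n → p.toValuationSubring} :
    x ∈ integralPoints p V ↔ inclVec p x ∈ V := Iff.rfl

/-- **`V̄`**: the subspace of `κⁿ` formed by the reductions `x̄` of the points `x ∈ V ∩ 𝒪ⁿ`.
[cite: RoyWaldschmidt1997ENS, §4, p. 773] -/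
def reduction (V : Submodule K (n → K)) : Submodule p.residueField (n → p.residueField) :=
  span p.residueField (redVec p '' (integralPoints p V : Set (n → p.toValuationSubring)))

/-- `x̄ ∈ V̄` for `x ∈ V ∩ 𝒪ⁿ`. [cite: RoyWaldschmidt1997ENS, §4, p. 773] -/
theorem redVec_mem_reduction {V : Submodule K (n → K)} {x : n → p.toValuationSubring}
    (hx : x ∈ integralPoints p V) : redVec p x ∈ reduction p V :=
  subset_span ⟨x, hx, rfl⟩

/-- The reductions `x̄`, `x ∈ V ∩ 𝒪ⁿ`, already form a `κ`-subspace (the reduction map is semilinear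
over the surjection `r : 𝒪 → κ`): `y ∈ V̄ ↔ y = x̄` for some `x ∈ V ∩ 𝒪ⁿ`.
[cite: RoyWaldschmidt1997ENS, §4, p. 773] -/
theorem mem_reduction_iff {V : Submodule K (n → K)} {y : n → p.residueField} :
    y ∈ reduction p V ↔ ∃ x ∈ integralPoints p V, redVec p x = y := by
  constructor
  · intro hy
    induction hy using span_induction with
    | mem y hy =>
      obtain ⟨x, hx, rfl⟩ := hy
      exact ⟨x, hx, rfl⟩
    | zero => exact ⟨0, zero_mem _, redVec_zero p⟩
    | add y z _ _ hy hz =>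
      obtain ⟨x, hx, rfl⟩ := hy
      obtain ⟨x', hx', rfl⟩ := hz
      exact ⟨x + x', add_mem hx hx', redVec_add p x x'⟩
    | smul c y _ hy =>
      obtain ⟨x, hx, rfl⟩ := hy
      obtain ⟨c', rfl⟩ := IsLocalRing.residue_surjective c
      exact ⟨c' • x, smul_mem _ _ hx, redVec_smul p c' x⟩
  · rintro ⟨x, hx, rfl⟩
    exact redVec_mem_reduction p hx

/-- `V ≤ W ⇒ V̄ ≤ W̄`. [folklore] -/
theorem reduction_mono {V W : Submodule K (n → K)} (h : V ≤ W) : reduction p V ≤ reduction p W :=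
  span_mono (Set.image_mono fun _ hx ↦ h hx)

/-! ### Saturation and clearing denominators -/

/-- **`V ∩ 𝒪ⁿ` is saturated in `𝒪ⁿ`**: if `c y ∈ V ∩ 𝒪ⁿ` with `0 ≠ c ∈ 𝒪` then `y ∈ V ∩ 𝒪ⁿ`
(so `𝒪ⁿ/(V ∩ 𝒪ⁿ)` is torsion-free). [folklore] -/
theorem mem_integralPoints_of_smul_mem {V : Submodule K (n → K)} {c : p.toValuationSubring}
    (hc : c ≠ 0) {y : n → p.toValuationSubring} (h : c • y ∈ integralPoints p V) :
    y ∈ integralPoints p V := by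
  rw [mem_integralPoints, inclVec_smul] at h
  have hc' : (c : K) ≠ 0 := fun h0 ↦ hc (Subtype.ext h0)
  have := V.smul_mem (c : K)⁻¹ h
  rwa [inv_smul_smul₀ hc'] at this

variable [Fintype n]

/-- Powers of the uniformizer clear denominators: for `v ∈ Kⁿ` there is `N` with `π^N v ∈ 𝒪ⁿ`.
[folklore] -/
theorem exists_uniformizer_pow_smul_mem (v : n → K) :
    ∃ N : ℕ, ∀ i, (p.uniformizer : K) ^ N * v i ∈ p.toValuationSubring := by
  refine ⟨(-(min 0 (ordVec p v))).toNat, fun i ↦ ?_⟩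
  by_cases hi : v i = 0
  · rw [hi, mul_zero]; exact zero_mem _
  have hπ : (p.uniformizer : K) ^ (-(min 0 (ordVec p v))).toNat ≠ 0 :=
    pow_ne_zero _ p.coe_uniformizer_ne_zero
  rw [p.mem_toValuationSubring_iff_ord_nonneg (mul_ne_zero hπ hi), p.ord_mul_eq hπ hi,
    p.ord_pow p.coe_uniformizer_ne_zero, p.ord_uniformizer_eq_one, mul_one]
  have h1 := ordVec_le p hi
  have h2 : (0 : ℤ) ≤ ((-(min 0 (ordVec p v))).toNat : ℤ) := Nat.cast_nonneg _
  have h3 := Int.self_le_toNat (-(min 0 (ordVec p v)))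
  omega

/-- **Clearing denominators**: every `v ∈ V` is `c⁻¹ x` with `0 ≠ c ∈ 𝒪` and `x ∈ V ∩ 𝒪ⁿ`
("`V ∩ 𝒪ⁿ` engendre `V` sur `K`"). [cite: RoyWaldschmidt1997ENS, §4, p. 773] -/
theorem exists_smul_eq_inclVec {V : Submodule K (n → K)} {v : n → K} (hv : v ∈ V) :
    ∃ c : p.toValuationSubring, c ≠ 0 ∧ ∃ x ∈ integralPoints p V, inclVec p x = (c : K) • v := by
  obtain ⟨N, hN⟩ := exists_uniformizer_pow_smul_mem p v
  refine ⟨p.uniformizer ^ N, pow_ne_zero _ p.irreducible_uniformizer.ne_zero,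
    fun i ↦ ⟨(p.uniformizer : K) ^ N * v i, hN i⟩, ?_, ?_⟩
  · rw [mem_integralPoints]
    have : inclVec p (fun i ↦ (⟨(p.uniformizer : K) ^ N * v i, hN i⟩ : p.toValuationSubring)) =
        ((p.uniformizer : K) ^ N) • v := by
      ext i; simp [inclVec]
    rw [this]
    exact V.smul_mem _ hv
  · ext i
    simp [inclVec]

/-! ### The structure of `V ∩ 𝒪ⁿ`: an adapted basis (Smith normal form + saturation) -/

/-- **Adapted bases.** There are an `𝒪`-basis `b` of `𝒪ⁿ` and an injection `f : Fin m ↪ n` such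
that `b ∘ f` is an `𝒪`-basis of `V ∩ 𝒪ⁿ` ("puisque `𝒪` est un anneau principal … `V ∩ 𝒪ⁿ` est un
`𝒪`-module libre"; here from Mathlib's Smith normal form `bN i = aᵢ • b (f i)`, where the
saturation of `V ∩ 𝒪ⁿ` forces every `aᵢ` to be a unit). [cite: RoyWaldschmidt1997ENS, Lemme 4.3 (proof), p. 773] -/
theorem exists_adapted_basis (V : Submodule K (n → K)) :
    ∃ (m : ℕ) (b : Basis n p.toValuationSubring (n → p.toValuationSubring))
      (bN : Basis (Fin m) p.toValuationSubring (integralPoints p V)) (f : Fin m ↪ n),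
      ∀ i, (bN i : n → p.toValuationSubring) = b (f i) := by
  obtain ⟨m, snf⟩ := Submodule.smithNormalForm (Pi.basisFun p.toValuationSubring n)
    (integralPoints p V)
  -- every diagonal entry is a unit, by saturation
  have hmem : ∀ i, snf.bM (snf.f i) ∈ integralPoints p V := by
    intro i
    have ha0 : snf.a i ≠ 0 := by
      intro h0
      have := snf.snf i
      rw [h0, zero_smul] at this
      exact snf.bN.ne_zero i (Subtype.ext this)
    exact mem_integralPoints_of_smul_mem p ha0 (snf.snf i ▸ (snf.bN i).2)
  have hunit : ∀ i, IsUnit (snf.a i) := by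
    intro i
    have h := snf.repr_apply_embedding_eq_repr_smul ⟨snf.bM (snf.f i), hmem i⟩ (i := i)
    rw [Basis.repr_self, Finsupp.single_eq_same, map_smul, Finsupp.smul_apply, smul_eq_mul] at h
    exact IsUnit.of_mul_eq_one _ h.symm
  refine ⟨m, snf.bM, snf.bN.unitsSMul fun i ↦ (hunit i).unit⁻¹, snf.f, fun i ↦ ?_⟩
  rw [Basis.unitsSMul_apply, Submodule.coe_smul_of_tower, snf.snf i, Units.smul_def, smul_smul,
    IsUnit.val_inv_mul, one_smul]

/-- The reduction of an `𝒪`-basis of `𝒪ⁿ` is a `κ`-basis of `κⁿ`. [folklore] -/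
theorem linearIndependent_redVec_basis (b : Basis n p.toValuationSubring (n → p.toValuationSubring)) :
    LinearIndependent p.residueField (fun j ↦ redVec p (b j)) ∧
      span p.residueField (Set.range fun j ↦ redVec p (b j)) = ⊤ := by
  have hspan : span p.residueField (Set.range fun j ↦ redVec p (b j)) = ⊤ := by
    rw [eq_top_iff]
    rintro y -
    obtain ⟨x, rfl⟩ := redVec_surjective p y
    rw [← b.sum_repr x, redVec_sum]
    refine sum_mem fun j _ ↦ ?_
    rw [redVec_smul]
    exact smul_mem _ _ (subset_span ⟨j, rfl⟩)
  refine ⟨linearIndependent_of_top_le_span_of_card_eq_finrank hspan.ge ?_, hspan⟩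
  simp

omit [Fintype n] in
/-- With an adapted basis `b`, `f`: `V̄` is spanned by the reductions of the `b (f i)`.
[cite: RoyWaldschmidt1997ENS, Lemme 4.3 (proof), p. 773] -/
theorem reduction_eq_span_of_adapted {V : Submodule K (n → K)} {m : ℕ}
    (b : Basis n p.toValuationSubring (n → p.toValuationSubring))
    (bN : Basis (Fin m) p.toValuationSubring (integralPoints p V)) (f : Fin m ↪ n)
    (hb : ∀ i, (bN i : n → p.toValuationSubring) = b (f i)) :
    reduction p V = span p.residueField (Set.range fun i ↦ redVec p (b (f i))) := by
  refine le_antisymm ?_ ?_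
  · rw [reduction, span_le]
    rintro _ ⟨x, hx, rfl⟩
    have hx' : x = ∑ i, (bN.repr ⟨x, hx⟩ i) • b (f i) := by
      have h := congrArg Subtype.val (bN.sum_repr ⟨x, hx⟩)
      simp only [Submodule.coe_sum, Submodule.coe_smul_of_tower, hb] at h
      exact h.symm
    rw [hx', redVec_sum]
    refine sum_mem fun i _ ↦ ?_
    rw [redVec_smul]
    exact smul_mem _ _ (subset_span ⟨i, rfl⟩)
  · rw [span_le]
    rintro _ ⟨i, rfl⟩
    exact redVec_mem_reduction p (by rw [← hb]; exact (bN i).2)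

/-- With an adapted basis, the vectors `b (f i)` (viewed in `Kⁿ`) form a `K`-basis of `V`.
[cite: RoyWaldschmidt1997ENS, Lemme 4.3 (proof), p. 773] -/
theorem basis_of_adapted {V : Submodule K (n → K)} {m : ℕ}
    (b : Basis n p.toValuationSubring (n → p.toValuationSubring))
    (bN : Basis (Fin m) p.toValuationSubring (integralPoints p V)) (f : Fin m ↪ n)
    (hb : ∀ i, (bN i : n → p.toValuationSubring) = b (f i)) :
    LinearIndependent K (fun i ↦ inclVec p (b (f i))) ∧
      span K (Set.range fun i ↦ inclVec p (b (f i))) = V := by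
  have hmemV : ∀ i, inclVec p (b (f i)) ∈ V := fun i ↦ by
    rw [← mem_integralPoints, ← hb]; exact (bN i).2
  constructor
  · rw [Fintype.linearIndependent_iff]
    intro a ha
    -- clear denominators in the coefficients
    obtain ⟨c, hc, x, -, hx⟩ := exists_smul_eq_inclVec p (V := ⊤) (v := a) mem_top
    have hsum : ∑ i, x i • b (f i) = 0 := by
      rw [← inclVec_eq_zero_iff p, inclVec_sum]
      simp only [inclVec_smul]
      have hxi : ∀ i, (x i : K) = (c : K) * a i := fun i ↦ by
        simpa [inclVec] using congr_fun hx i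
      simp only [hxi, mul_smul, ← Finset.smul_sum, ha, smul_zero]
    have hli := Fintype.linearIndependent_iff.1 (b.linearIndependent.comp f f.injective) x hsum
    intro i
    have := congr_fun hx i
    simp only [inclVec_apply, hli i, ZeroMemClass.coe_zero, Pi.smul_apply, smul_eq_mul] at this
    exact (mul_eq_zero.1 this.symm).resolve_left fun h0 ↦ hc (Subtype.ext h0)
  · refine le_antisymm (span_le.2 ?_) fun v hv ↦ ?_
    · rintro _ ⟨i, rfl⟩; exact hmemV i
    · obtain ⟨c, hc, x, hx, hxv⟩ := exists_smul_eq_inclVec p hv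
      have hc' : (c : K) ≠ 0 := fun h0 ↦ hc (Subtype.ext h0)
      have hx' : x = ∑ i, (bN.repr ⟨x, hx⟩ i) • b (f i) := by
        have h := congrArg Subtype.val (bN.sum_repr ⟨x, hx⟩)
        simp only [Submodule.coe_sum, Submodule.coe_smul_of_tower, hb] at h
        exact h.symm
      have hv' : v = (c : K)⁻¹ • inclVec p x := by rw [hxv, inv_smul_smul₀ hc']
      rw [hv', hx', inclVec_sum]
      refine smul_mem _ _ (sum_mem fun i _ ↦ ?_)
      rw [inclVec_smul]
      exact smul_mem _ _ (subset_span ⟨i, rfl⟩)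

/-- **Roy–Waldschmidt, Lemme 4.3 (first assertion): `dim_κ(V̄) = dim_K(V)`.**
[cite: RoyWaldschmidt1997ENS, Lemme 4.3, p. 773] -/
theorem finrank_reduction (V : Submodule K (n → K)) :
    finrank p.residueField (reduction p V) = finrank K V := by
  obtain ⟨m, b, bN, f, hb⟩ := exists_adapted_basis p V
  have h1 : finrank p.residueField (reduction p V) = m := by
    have hli : LinearIndependent p.residueField (fun i ↦ redVec p (b (f i))) :=
      (linearIndependent_redVec_basis p b).1.comp f f.injective
    rw [reduction_eq_span_of_adapted p b bN f hb, finrank_span_eq_card hli]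
    simp
  have h2 : finrank K V = m := by
    obtain ⟨hli, hspan⟩ := basis_of_adapted p b bN f hb
    rw [← hspan, finrank_span_eq_card hli]
    simp
  rw [h1, h2]

/-- The rank of `V ∩ 𝒪ⁿ` over `𝒪` is `dim_K V` as well. [cite: RoyWaldschmidt1997ENS, Lemme 4.3, p. 773] -/
theorem finrank_integralPoints (V : Submodule K (n → K)) :
    finrank p.toValuationSubring (integralPoints p V) = finrank K V := by
  obtain ⟨m, b, bN, f, hb⟩ := exists_adapted_basis p V
  obtain ⟨hli, hspan⟩ := basis_of_adapted p b bN f hb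
  rw [finrank_eq_card_basis bN, ← hspan, finrank_span_eq_card hli]


/-! ### Transfer between `𝒪ⁿ` and `Kⁿ` -/

omit [Fintype n] in
/-- An `𝒪`-linearly independent family of integral vectors is `K`-linearly independent
(clear denominators in a `K`-relation). [folklore] -/
theorem linearIndependent_inclVec {r : Type*} [Fintype r] {x : r → n → p.toValuationSubring}
    (hx : LinearIndependent p.toValuationSubring x) :
    LinearIndependent K (fun i ↦ inclVec p (x i)) := by
  rw [Fintype.linearIndependent_iff]
  intro a ha
  obtain ⟨c, hc, y, -, hy⟩ := exists_smul_eq_inclVec p (V := ⊤) (v := a) mem_top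
  have hyi : ∀ i, (y i : K) = (c : K) * a i := fun i ↦ by simpa [inclVec] using congr_fun hy i
  have hsum : ∑ i, y i • x i = 0 := by
    rw [← inclVec_eq_zero_iff p, inclVec_sum]
    simp only [inclVec_smul, hyi, mul_smul, ← Finset.smul_sum, ha, smul_zero]
  have hli := Fintype.linearIndependent_iff.1 hx y hsum
  intro i
  have h := hyi i
  rw [hli i, ZeroMemClass.coe_zero] at h
  exact (mul_eq_zero.1 h.symm).resolve_left fun h0 ↦ hc (Subtype.ext h0)

/-- If integral vectors `xᵢ ∈ V` span `V ∩ 𝒪ⁿ` over `𝒪`, they span `V` over `K`. [folklore] -/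
theorem span_inclVec_eq {V : Submodule K (n → K)} {r : Type*} [Fintype r]
    {x : r → n → p.toValuationSubring} (hx : ∀ i, x i ∈ integralPoints p V)
    (h : integralPoints p V ≤ span p.toValuationSubring (Set.range x)) :
    span K (Set.range fun i ↦ inclVec p (x i)) = V := by
  refine le_antisymm (span_le.2 ?_) fun v hv ↦ ?_
  · rintro _ ⟨i, rfl⟩; exact hx i
  · obtain ⟨c, hc, y, hy, hyv⟩ := exists_smul_eq_inclVec p hv
    have hc' : (c : K) ≠ 0 := fun h0 ↦ hc (Subtype.ext h0)
    obtain ⟨d, hd⟩ := (Submodule.mem_span_range_iff_exists_fun _).1 (h hy)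
    have hv' : v = (c : K)⁻¹ • inclVec p y := by rw [hyv, inv_smul_smul₀ hc']
    rw [hv', ← hd, inclVec_sum]
    refine smul_mem _ _ (sum_mem fun i _ ↦ ?_)
    rw [inclVec_smul]
    exact smul_mem _ _ (subset_span ⟨i, rfl⟩)

/-! ### Maximal minors (Plücker coordinates of `x₁ ∧ ⋯ ∧ x_m`) -/

section Minors

variable {F : Type*} [CommRing F] {r : Type*} [Fintype r] [DecidableEq r]

omit [Fintype n] in
/-- The maximal minors of the matrix with rows `xᵢ` (`i ∈ r`), indexed by the choices
`f : r → n` of `|r|` columns (repeated columns give `0`): the Plücker coordinates of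
`x₁ ∧ ⋯ ∧ x_m`, through which the paper's `ord_𝔭(x₁ ∧ ⋯ ∧ x_m)` and `h(x₁ ∧ ⋯ ∧ x_m)` are read.
[cite: RoyWaldschmidt1997ENS, §4, p. 773] -/
def minors (x : r → n → F) : (r → n) → F := fun f ↦ (Matrix.of fun i j ↦ x i (f j)).det

omit [Fintype n] in
/-- Unfolding of `minors`. [folklore] -/
theorem minors_apply (x : r → n → F) (f : r → n) :
    minors x f = (Matrix.of fun i j ↦ x i (f j)).det := rfl

omit [Fintype n] in
/-- Minors commute with ring homomorphisms (reduction, inclusion `𝒪 ⊆ K`). [folklore] -/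
theorem map_minors {F' : Type*} [CommRing F'] (φ : F →+* F') (x : r → n → F) (f : r → n) :
    φ (minors x f) = minors (fun i j ↦ φ (x i j)) f := by
  rw [minors_apply, minors_apply, RingHom.map_det, RingHom.mapMatrix_apply]
  rfl

omit [Fintype n] in
/-- A nonvanishing maximal minor forces the rows to be linearly independent. [folklore] -/
theorem linearIndependent_of_minors_ne_zero [NoZeroDivisors F] {x : r → n → F} (f : r → n)
    (h : minors x f ≠ 0) : LinearIndependent F x := by
  rw [Fintype.linearIndependent_iff]
  intro a ha i
  have hv : Matrix.vecMul a (Matrix.of fun i j ↦ x i (f j)) = 0 := by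
    ext j
    have := congr_fun ha (f j)
    simp only [Finset.sum_apply, Pi.smul_apply, smul_eq_mul, Pi.zero_apply] at this
    simpa [Matrix.vecMul, dotProduct] using this
  exact congr_fun (Matrix.eq_zero_of_vecMul_eq_zero h hv) i

/-- **Linearly independent rows have a nonvanishing maximal minor** (over a field): the
columns span `F^r`, a maximal independent set of columns is a basis, and the corresponding square
submatrix is invertible. [folklore] -/
theorem exists_minors_ne_zero {F : Type*} [Field F] {x : r → n → F} (hx : LinearIndependent F x) :
    ∃ f : r ↪ n, minors x f ≠ 0 := by
  -- the columns
  set c : n → (r → F) := fun j i ↦ x i j with hc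
  -- they span `F^r`
  have hspan : span F (Set.range c) = ⊤ := by
    by_contra hne
    obtain ⟨φ, hφ0, hle⟩ := Submodule.exists_le_ker_of_lt_top _ (lt_top_iff_ne_top.2 hne)
    set a : r → F := fun i ↦ φ (Pi.single i 1) with ha
    have hφ : ∀ y : r → F, φ y = ∑ i, y i * a i := by
      intro y
      conv_lhs => rw [show y = ∑ i, y i • (Pi.single i 1 : r → F) from by
        ext j; simp [Finset.sum_apply, Pi.single_apply]]
      rw [map_sum]
      simp only [map_smul, smul_eq_mul, ha]
    have hcol : ∀ j, ∑ i, x i j * a i = 0 := fun j ↦ by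
      rw [← hφ (c j)]; exact LinearMap.mem_ker.1 (hle (subset_span ⟨j, rfl⟩))
    have hsum : ∑ i, a i • x i = 0 := by
      ext j
      simp only [Finset.sum_apply, Pi.smul_apply, smul_eq_mul, Pi.zero_apply]
      rw [← hcol j]
      exact Finset.sum_congr rfl fun i _ ↦ mul_comm _ _
    have ha0 := Fintype.linearIndependent_iff.1 hx a hsum
    exact hφ0 (LinearMap.ext fun y ↦ by simp [hφ y, ha0])
  -- a maximal independent set of columns is a basis
  obtain ⟨s, hli, hmax⟩ := exists_maximal_linearIndepOn F c
  have hspan_s : span F (c '' s) = ⊤ := by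
    rw [eq_top_iff, ← hspan, span_le]
    rintro _ ⟨j, rfl⟩
    by_cases hj : j ∈ s
    · exact subset_span ⟨j, hj, rfl⟩
    · obtain ⟨a, ha, hmem⟩ := hmax j hj
      have := Submodule.smul_mem _ a⁻¹ hmem
      rwa [inv_smul_smul₀ ha] at this
  have hli' : LinearIndependent F (fun j : s ↦ c j) := hli
  have hrange : Set.range (fun j : s ↦ c j) = c '' s := by
    ext y; simp
  let B : Basis s F (r → F) := Basis.mk hli' (by rw [hrange, hspan_s])
  have hcard : Fintype.card r = Fintype.card s := by
    rw [← Module.finrank_eq_card_basis B, Module.finrank_fintype_fun_eq_card]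
  obtain ⟨e⟩ : Nonempty (r ≃ s) := Fintype.card_eq.1 hcard
  refine ⟨e.toEmbedding.trans (Function.Embedding.subtype _), ?_⟩
  have hcols : LinearIndependent F
      (Matrix.of fun i j ↦ x i ((e.toEmbedding.trans (Function.Embedding.subtype _)) j)).col := by
    have heq : (Matrix.of fun i j ↦ x i ((e.toEmbedding.trans (Function.Embedding.subtype _)) j)).col
        = fun j ↦ c (e j) := by
      funext j i; rfl
    rw [heq]
    exact hli'.comp e e.injective
  have hU := Matrix.linearIndependent_cols_iff_isUnit.1 hcols
  rw [Matrix.isUnit_iff_isUnit_det] at hU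
  exact hU.ne_zero

end Minors

/-! ### Orders of integral elements: units -/

omit [Fintype n] in
/-- An element of `𝒪` of order `0` is a unit of `𝒪`. [folklore] -/
theorem isUnit_of_ord_eq_zero (a : p.toValuationSubring) (ha : (a : K) ≠ 0) (h : p.ord (a : K) = 0) :
    IsUnit a := by
  have hmem' : (a : K)⁻¹ ∈ p.toValuationSubring := by
    rw [p.mem_toValuationSubring_iff_ord_nonneg (inv_ne_zero ha), p.ord_inv ha, h, neg_zero]
  exact IsUnit.of_mul_eq_one ⟨(a : K)⁻¹, hmem'⟩ (Subtype.ext (by simp [ha]))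

omit [Fintype n] in
/-- `a ∈ 𝒪` is a unit iff its reduction `ā` is nonzero. [folklore] -/
theorem isUnit_iff_residue_ne_zero (a : p.toValuationSubring) :
    IsUnit a ↔ IsLocalRing.residue p.toValuationSubring a ≠ 0 := by
  rw [Ne, IsLocalRing.residue_eq_zero_iff]
  exact (IsLocalRing.notMem_maximalIdeal).symm

/-! ### Regular bases (Lemme 4.3) -/

variable {r : Type*} [Fintype r]

/-- **Regular basis** of `V` at `𝔭` (Roy–Waldschmidt, p. 774): a family `x₁, …, x_m` of points
of `V ∩ 𝒪ⁿ` whose reductions `x̄₁, …, x̄_m` form a basis of `V̄` (condition (ii) of Lemme 4.3;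
conditions (i) and (iii) are then theorems: `IsRegularBasis.linearIndependent_int`,
`.span_int_eq`, `.linearIndependent`, `.span_eq`, `.exists_isUnit_minors`,
`.ordVec_minors_eq_zero`, and conversely `isRegularBasis_of_basis_int`,
`isRegularBasis_of_ordVec_minors_eq_zero`). [cite: RoyWaldschmidt1997ENS, Lemme 4.3 and p. 774] -/
structure IsRegularBasis (V : Submodule K (n → K)) (x : r → n → p.toValuationSubring) : Prop where
  /-- The vectors lie in `V ∩ 𝒪ⁿ`. -/
  mem : ∀ i, x i ∈ integralPoints p V
  /-- Their reductions are linearly independent over `κ` … -/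
  linearIndependent_red : LinearIndependent p.residueField fun i ↦ redVec p (x i)
  /-- … and span `V̄`. -/
  span_red : span p.residueField (Set.range fun i ↦ redVec p (x i)) = reduction p V

namespace IsRegularBasis

variable {p}
variable {V : Submodule K (n → K)} {x : r → n → p.toValuationSubring}

/-- A regular basis has `dim_K V` elements. [cite: RoyWaldschmidt1997ENS, Lemme 4.3, p. 773] -/
theorem card_eq (h : IsRegularBasis p V x) : Fintype.card r = finrank K V := by
  rw [← finrank_reduction p V, ← h.span_red, finrank_span_eq_card h.linearIndependent_red]

/-- **Lemme 4.3, (ii) ⇒ (i), integral part**: a regular basis is an `𝒪`-basis of `V ∩ 𝒪ⁿ` —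
linear independence. [cite: RoyWaldschmidt1997ENS, Lemme 4.3, p. 773] -/
theorem linearIndependent_int_and_span_int_eq (h : IsRegularBasis p V x) :
    LinearIndependent p.toValuationSubring x ∧
      span p.toValuationSubring (Set.range x) = integralPoints p V := by
  classical
  -- an adapted basis, reindexed by `r`
  obtain ⟨m, b, bN, f, hb⟩ := exists_adapted_basis p V
  have hcard : Fintype.card r = Fintype.card (Fin m) := by
    rw [h.card_eq, ← finrank_integralPoints p V, finrank_eq_card_basis bN]
  obtain ⟨e⟩ : Nonempty (r ≃ Fin m) := Fintype.card_eq.1 hcard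
  set B : Basis r p.toValuationSubring (integralPoints p V) := bN.reindex e.symm with hB
  have hBval : ∀ i, (B i : n → p.toValuationSubring) = b (f (e i)) := fun i ↦ by
    rw [hB, Basis.reindex_apply, Equiv.symm_symm, hb]
  -- the family `x` inside `V ∩ 𝒪ⁿ`, and its matrix `A` in the basis `B`
  set xN : r → integralPoints p V := fun i ↦ ⟨x i, h.mem i⟩ with hxN
  set A : Matrix r r p.toValuationSubring := B.toMatrix xN with hA
  have hxA : ∀ j, x j = ∑ i, A i j • b (f (e i)) := by
    intro j
    have h1 := congrArg Subtype.val (B.sum_repr (xN j))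
    simp only [Submodule.coe_sum, Submodule.coe_smul_of_tower, hBval] at h1
    exact h1.symm
  -- the reduced basis `B̄` of `V̄` and the reduced family
  have hBred_li : LinearIndependent p.residueField fun i ↦ redVec p (b (f (e i))) :=
    ((linearIndependent_redVec_basis p b).1.comp f f.injective).comp e e.injective
  have hBred_span : span p.residueField (Set.range fun i ↦ redVec p (b (f (e i)))) =
      reduction p V := by
    rw [reduction_eq_span_of_adapted p b bN f hb]
    congr 1
    ext y
    simp only [Set.mem_range]
    constructor
    · rintro ⟨i, rfl⟩; exact ⟨e i, rfl⟩
    · rintro ⟨i, rfl⟩; exact ⟨e.symm i, by simp⟩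
  set W := reduction p V with hW
  have hBmemW : ∀ i, redVec p (b (f (e i))) ∈ W := fun i ↦
    hBred_span ▸ subset_span ⟨i, rfl⟩
  have hxmemW : ∀ i, redVec p (x i) ∈ W := fun i ↦ redVec_mem_reduction p (h.mem i)
  set Bbar' : r → W := fun i ↦ ⟨redVec p (b (f (e i))), hBmemW i⟩ with hBbar'
  set xbar' : r → W := fun i ↦ ⟨redVec p (x i), hxmemW i⟩ with hxbar'
  have hBbar'_li : LinearIndependent p.residueField Bbar' :=
    (LinearIndependent.of_comp W.subtype (by exact hBred_li))
  have hBbar'_span : span p.residueField (Set.range Bbar') = ⊤ := by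
    apply Submodule.map_injective_of_injective W.injective_subtype
    rw [Submodule.map_span, Submodule.map_top, Submodule.range_subtype, ← Set.range_comp]
    exact hBred_span
  set Bbar : Basis r p.residueField W := Basis.mk hBbar'_li hBbar'_span.ge with hBbar
  have hBbar_apply : ∀ i, Bbar i = Bbar' i := fun i ↦ by rw [hBbar, Basis.mk_apply]
  have hxbar'_li : LinearIndependent p.residueField xbar' :=
    (LinearIndependent.of_comp W.subtype (by exact h.linearIndependent_red))
  have hxbar'_span : span p.residueField (Set.range xbar') = ⊤ := by
    apply Submodule.map_injective_of_injective W.injective_subtype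
    rw [Submodule.map_span, Submodule.map_top, Submodule.range_subtype, ← Set.range_comp]
    exact h.span_red
  -- the matrix of `x̄` in `B̄` is the reduction of `A`
  have hxbar_eq : ∀ j, xbar' j = ∑ i, IsLocalRing.residue _ (A i j) • Bbar i := by
    intro j
    apply Subtype.ext
    simp only [hxbar', Submodule.coe_sum, Submodule.coe_smul, hBbar_apply, hBbar']
    rw [hxA j, redVec_sum]
    simp only [redVec_smul]
  have htoMatrix : Bbar.toMatrix xbar' = A.map (IsLocalRing.residue p.toValuationSubring) := by
    ext i j
    rw [Basis.toMatrix_apply, hxbar_eq j, Basis.repr_sum_self]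
    rfl
  -- hence `det A` is a unit
  have hdetbar : IsUnit (Bbar.det xbar') := (Bbar.is_basis_iff_det).1 ⟨hxbar'_li, hxbar'_span⟩
  rw [Basis.det_apply, htoMatrix, ← RingHom.mapMatrix_apply, ← RingHom.map_det] at hdetbar
  have hdetA : IsUnit A.det := (isUnit_map_iff (IsLocalRing.residue p.toValuationSubring) _).1 hdetbar
  have hbasis := (B.is_basis_iff_det (v := xN)).2 (by rwa [Basis.det_apply])
  -- transfer from `V ∩ 𝒪ⁿ` (as a type) to `𝒪ⁿ`
  refine ⟨?_, ?_⟩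
  · exact hbasis.1.map' (integralPoints p V).subtype (Submodule.ker_subtype _)
  · have h2 := congrArg (Submodule.map (integralPoints p V).subtype) hbasis.2
    rw [Submodule.map_span, Submodule.map_top, Submodule.range_subtype, ← Set.range_comp] at h2
    exact h2

/-- **Lemme 4.3, (ii) ⇒ (i)**: a regular basis is `𝒪`-linearly independent …
[cite: RoyWaldschmidt1997ENS, Lemme 4.3, p. 773] -/
theorem linearIndependent_int (h : IsRegularBasis p V x) : LinearIndependent p.toValuationSubring x :=
  h.linearIndependent_int_and_span_int_eq.1

/-- … and spans `V ∩ 𝒪ⁿ` over `𝒪`. [cite: RoyWaldschmidt1997ENS, Lemme 4.3, p. 773] -/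
theorem span_int_eq (h : IsRegularBasis p V x) :
    span p.toValuationSubring (Set.range x) = integralPoints p V :=
  h.linearIndependent_int_and_span_int_eq.2

/-- **Lemme 4.3, (ii) ⇒ (i)**: a regular basis is a `K`-basis of `V` — independence.
[cite: RoyWaldschmidt1997ENS, Lemme 4.3, p. 773] -/
theorem linearIndependent (h : IsRegularBasis p V x) :
    LinearIndependent K fun i ↦ inclVec p (x i) :=
  linearIndependent_inclVec p h.linearIndependent_int

/-- … and spanning. [cite: RoyWaldschmidt1997ENS, Lemme 4.3, p. 773] -/
theorem span_eq (h : IsRegularBasis p V x) : span K (Set.range fun i ↦ inclVec p (x i)) = V :=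
  span_inclVec_eq p h.mem h.span_int_eq.ge

/-- **Lemme 4.3, (ii) ⇒ (iii)**: some maximal minor of a regular basis is a unit of `𝒪`.
[cite: RoyWaldschmidt1997ENS, Lemme 4.3, p. 773] -/
theorem exists_isUnit_minors [DecidableEq r] (h : IsRegularBasis p V x) :
    ∃ f : r ↪ n, IsUnit (minors x f) := by
  obtain ⟨f, hf⟩ := exists_minors_ne_zero h.linearIndependent_red
  refine ⟨f, (isUnit_iff_residue_ne_zero p _).2 ?_⟩
  rwa [map_minors]

/-- **Lemme 4.3, (ii) ⇒ (iii)**: `ord_𝔭(x₁ ∧ ⋯ ∧ x_m) = 0` for a regular basis, the exterior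
product being read through its Plücker coordinates (and `x₁ ∧ ⋯ ∧ x_m ≠ 0`).
[cite: RoyWaldschmidt1997ENS, Lemme 4.3, p. 773] -/
theorem ordVec_minors_eq_zero [DecidableEq r] (h : IsRegularBasis p V x) :
    (fun f : r → n ↦ ((minors x f : p.toValuationSubring) : K)) ≠ 0 ∧ ordVec p (fun f : r → n ↦ ((minors x f : p.toValuationSubring) : K)) = 0 := by
  obtain ⟨f, hf⟩ := h.exists_isUnit_minors
  have hf0 : ((minors x f : p.toValuationSubring) : K) ≠ 0 := fun h0 ↦ hf.ne_zero (Subtype.ext h0)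
  have hne : (fun f : r → n ↦ ((minors x f : p.toValuationSubring) : K)) ≠ 0 := fun h0 ↦ hf0 (congr_fun h0 f)
  refine ⟨hne, le_antisymm ?_ ?_⟩
  · have := ordVec_le p (x := fun f : r → n ↦ ((minors x f : p.toValuationSubring) : K)) (i := f) hf0
    rwa [PlaceOver.ord_eq_zero_of_isUnit p (minors x f).2 (by simpa using hf)] at this
  · rw [le_ordVec_iff p hne]
    intro g hg
    exact PlaceOver.ord_nonneg_of_mem p (minors x g).2

end IsRegularBasis

variable {p} in
/-- **Lemme 4.3, (i) ⇒ (ii)**: an `𝒪`-basis of `V ∩ 𝒪ⁿ` is a regular basis.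
[cite: RoyWaldschmidt1997ENS, Lemme 4.3, p. 773] -/
theorem isRegularBasis_of_basis_int {V : Submodule K (n → K)} {x : r → n → p.toValuationSubring}
    (hx : ∀ i, x i ∈ integralPoints p V) (hli : LinearIndependent p.toValuationSubring x)
    (hspan : integralPoints p V ≤ span p.toValuationSubring (Set.range x)) :
    IsRegularBasis p V x := by
  -- the reductions span `V̄`
  have hspan_red : span p.residueField (Set.range fun i ↦ redVec p (x i)) = reduction p V := by
    refine le_antisymm (span_le.2 ?_) fun y hy ↦ ?_
    · rintro _ ⟨i, rfl⟩; exact redVec_mem_reduction p (hx i)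
    · obtain ⟨z, hz, rfl⟩ := (mem_reduction_iff p).1 hy
      obtain ⟨c, hc⟩ := (Submodule.mem_span_range_iff_exists_fun _).1 (hspan hz)
      rw [← hc, redVec_sum]
      refine sum_mem fun i _ ↦ ?_
      rw [redVec_smul]
      exact smul_mem _ _ (subset_span ⟨i, rfl⟩)
  -- `x` is an `𝒪`-basis of `V ∩ 𝒪ⁿ`, hence `|r| = dim_K V = dim_κ V̄`
  have hcard : Fintype.card r = finrank p.residueField (reduction p V) := by
    set xN : r → integralPoints p V := fun i ↦ ⟨x i, hx i⟩ with hxN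
    have hliN : LinearIndependent p.toValuationSubring xN :=
      LinearIndependent.of_comp (integralPoints p V).subtype (by exact hli)
    have hspanN : ⊤ ≤ span p.toValuationSubring (Set.range xN) := by
      rintro ⟨z, hz⟩ -
      obtain ⟨c, hc⟩ := (Submodule.mem_span_range_iff_exists_fun _).1 (hspan hz)
      have heq : (⟨z, hz⟩ : integralPoints p V) = ∑ i, c i • xN i := by
        apply Subtype.ext
        simp only [hxN, Submodule.coe_sum, Submodule.coe_smul_of_tower]
        exact hc.symm
      rw [heq]
      exact sum_mem fun i _ ↦ smul_mem _ _ (subset_span ⟨i, rfl⟩)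
    have B := Basis.mk hliN hspanN
    rw [finrank_reduction, ← finrank_integralPoints p V, finrank_eq_card_basis B]
  -- independence of the reductions, inside `V̄`
  have hmemW : ∀ i, redVec p (x i) ∈ reduction p V := fun i ↦ redVec_mem_reduction p (hx i)
  set xbar' : r → reduction p V := fun i ↦ ⟨redVec p (x i), hmemW i⟩ with hxbar'
  have hspan' : ⊤ ≤ span p.residueField (Set.range xbar') := by
    rintro ⟨y, hy⟩ -
    have hy' : y ∈ span p.residueField (Set.range fun i ↦ redVec p (x i)) := by
      rw [hspan_red]; exact hy
    obtain ⟨c, hc⟩ := (Submodule.mem_span_range_iff_exists_fun _).1 hy'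
    have heq : (⟨y, hy⟩ : reduction p V) = ∑ i, c i • xbar' i := by
      apply Subtype.ext
      simp only [hxbar', Submodule.coe_sum, Submodule.coe_smul]
      exact hc.symm
    rw [heq]
    exact sum_mem fun i _ ↦ smul_mem _ _ (subset_span ⟨i, rfl⟩)
  have hli' : LinearIndependent p.residueField xbar' :=
    linearIndependent_of_top_le_span_of_card_eq_finrank hspan' hcard
  exact ⟨hx, hli'.map' _ (Submodule.ker_subtype _), hspan_red⟩

variable {p} in
/-- **Lemme 4.3, (iii) ⇒ (ii)**: if `m = dim_K V` integral points `x₁, …, x_m` of `V` have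
`x₁ ∧ ⋯ ∧ x_m ≠ 0` and `ord_𝔭(x₁ ∧ ⋯ ∧ x_m) = 0`, they form a regular basis.
[cite: RoyWaldschmidt1997ENS, Lemme 4.3, p. 773] -/
theorem isRegularBasis_of_ordVec_minors_eq_zero [DecidableEq r] {V : Submodule K (n → K)}
    {x : r → n → p.toValuationSubring} (hx : ∀ i, x i ∈ integralPoints p V)
    (hcard : Fintype.card r = finrank K V) (hne : (fun f : r → n ↦ ((minors x f : p.toValuationSubring) : K)) ≠ 0)
    (hord : ordVec p (fun f : r → n ↦ ((minors x f : p.toValuationSubring) : K)) = 0) : IsRegularBasis p V x := by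
  obtain ⟨f, hf0, hf⟩ := exists_ordVec_eq p hne
  rw [hord] at hf
  have hunit : IsUnit (minors x f) := isUnit_of_ord_eq_zero p _ hf0 hf.symm
  have hres : minors (fun i ↦ redVec p (x i)) f ≠ 0 := by
    have := (isUnit_iff_residue_ne_zero p _).1 hunit
    rwa [map_minors] at this
  have hli : LinearIndependent p.residueField fun i ↦ redVec p (x i) :=
    linearIndependent_of_minors_ne_zero f hres
  -- spanning, by counting dimensions inside `V̄`
  have hmemW : ∀ i, redVec p (x i) ∈ reduction p V := fun i ↦ redVec_mem_reduction p (hx i)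
  set xbar' : r → reduction p V := fun i ↦ ⟨redVec p (x i), hmemW i⟩ with hxbar'
  have hli' : LinearIndependent p.residueField xbar' :=
    LinearIndependent.of_comp (reduction p V).subtype (by exact hli)
  have hspan' : span p.residueField (Set.range xbar') = ⊤ :=
    hli'.span_eq_top_of_card_eq_finrank' (by rw [hcard, finrank_reduction])
  refine ⟨hx, hli, ?_⟩
  have h2 := congrArg (Submodule.map (reduction p V).subtype) hspan'
  rw [Submodule.map_span, Submodule.map_top, Submodule.range_subtype, ← Set.range_comp] at h2
  exact h2

/-! ### Regular bases: complements -/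

omit [Fintype n] in
/-- Minors of integral vectors are integral. [folklore] -/
theorem minors_inclVec_eq {r : Type*} [Fintype r] [DecidableEq r]
    (x : r → n → p.toValuationSubring) (f : r → n) :
    minors (fun i ↦ inclVec p (x i)) f = ((minors x f : p.toValuationSubring) : K) := by
  rw [show ((minors x f : p.toValuationSubring) : K) = algebraMap p.toValuationSubring K (minors x f)
    from rfl, map_minors]
  rfl

/-- `ord_𝔭(x₁ ∧ ⋯ ∧ x_m) ≥ 0` for integral vectors `xᵢ ∈ 𝒪ⁿ`. [cite: RoyWaldschmidt1997ENS, §4, p. 774] -/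
theorem ordVec_minors_inclVec_nonneg {r : Type*} [Fintype r] [DecidableEq r]
    (x : r → n → p.toValuationSubring) : 0 ≤ ordVec p (minors fun i ↦ inclVec p (x i)) := by
  by_cases h0 : (minors fun i ↦ inclVec p (x i)) = 0
  · rw [h0, ordVec_zero]
  rw [le_ordVec_iff p h0]
  intro g _
  rw [minors_inclVec_eq]
  exact PlaceOver.ord_nonneg_of_mem p (minors x g).2

namespace IsRegularBasis

variable {p}
variable {V : Submodule K (n → K)} {x : r → n → p.toValuationSubring}

/-- **Lemme 4.3, (ii) ⇒ (iii)**, read in `Kⁿ`: `x₁ ∧ ⋯ ∧ x_m ≠ 0` and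
`ord_𝔭(x₁ ∧ ⋯ ∧ x_m) = 0`. [cite: RoyWaldschmidt1997ENS, Lemme 4.3, p. 773] -/
theorem minors_inclVec_ne_zero_and_ordVec_eq_zero [DecidableEq r] (h : IsRegularBasis p V x) :
    (minors fun i ↦ inclVec p (x i)) ≠ 0 ∧ ordVec p (minors fun i ↦ inclVec p (x i)) = 0 := by
  have heq : (minors fun i ↦ inclVec p (x i)) =
      fun f : r → n ↦ ((minors x f : p.toValuationSubring) : K) :=
    funext fun f ↦ minors_inclVec_eq p x f
  rw [heq]
  exact h.ordVec_minors_eq_zero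

omit [Fintype n] [Fintype r] in
/-- Regular bases are stable under reindexing. [folklore] -/
theorem comp_equiv {r' : Type*} (h : IsRegularBasis p V x) (e : r' ≃ r) :
    IsRegularBasis p V (x ∘ e) where
  mem i := h.mem (e i)
  linearIndependent_red := (linearIndependent_equiv e (f := fun i ↦ redVec p (x i))).2
    h.linearIndependent_red
  span_red := by
    rw [← h.span_red]
    congr 1
    exact (e.surjective.range_comp (fun i ↦ redVec p (x i)))

end IsRegularBasis

/-- **Regular bases exist** (Lemme 4.4 with `k = 0`; here read off from an adapted basis).
[cite: RoyWaldschmidt1997ENS, Lemme 4.4, p. 774] -/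
theorem exists_isRegularBasis (V : Submodule K (n → K)) :
    ∃ (m : ℕ) (x : Fin m → n → p.toValuationSubring), IsRegularBasis p V x := by
  obtain ⟨m, b, bN, f, hb⟩ := exists_adapted_basis p V
  refine ⟨m, fun i ↦ b (f i), isRegularBasis_of_basis_int (fun i ↦ ?_)
    (b.linearIndependent.comp f f.injective) fun z hz ↦ ?_⟩
  · rw [← hb]; exact (bN i).2
  · have hz' : z = ∑ i, (bN.repr ⟨z, hz⟩ i) • b (f i) := by
      have h := congrArg Subtype.val (bN.sum_repr ⟨z, hz⟩)
      simp only [Submodule.coe_sum, Submodule.coe_smul_of_tower, hb] at h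
      exact h.symm
    rw [hz']
    exact sum_mem fun i _ ↦ smul_mem _ _ (subset_span ⟨i, rfl⟩)

/-- The reindexed form: a regular basis indexed by any type of the right cardinality.
[cite: RoyWaldschmidt1997ENS, Lemme 4.4, p. 774] -/
theorem exists_isRegularBasis_of_card_eq (V : Submodule K (n → K)) (hr : Fintype.card r = finrank K V) :
    ∃ x : r → n → p.toValuationSubring, IsRegularBasis p V x := by
  obtain ⟨m, x, hx⟩ := exists_isRegularBasis p V
  have hm : Fintype.card r = Fintype.card (Fin m) := by rw [hr, ← hx.card_eq]
  obtain ⟨e⟩ : Nonempty (r ≃ Fin m) := Fintype.card_eq.1 hm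
  exact ⟨x ∘ e, hx.comp_equiv e⟩

/-! ### Lemme 4.4: completing to a regular basis -/

section Extension

variable {F M : Type*} [Field F] [AddCommGroup M] [Module F M]

/-- One extension step: if `Sum.elim v w` is linearly independent and `u` is not in its span,
then `Sum.elim v (Fin.snoc w u)` is linearly independent. [folklore] -/
theorem linearIndependent_sum_snoc {ι : Type*} [Fintype ι] {v : ι → M} {j : ℕ} {w : Fin j → M}
    (h : LinearIndependent F (Sum.elim v w)) {u : M}
    (hu : u ∉ span F (Set.range (Sum.elim v w))) :
    LinearIndependent F (Sum.elim v (Fin.snoc w u : Fin (j + 1) → M)) := by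
  classical
  rw [Fintype.linearIndependent_iff]
  intro c hc
  rw [Fintype.sum_sum_type, Fin.sum_univ_castSucc] at hc
  simp only [Sum.elim_inl, Sum.elim_inr, Fin.snoc_castSucc, Fin.snoc_last, ← add_assoc] at hc
  -- the coefficient of `u` vanishes
  have hlast : c (Sum.inr (Fin.last j)) = 0 := by
    by_contra hne
    apply hu
    have hu_eq : u = -(c (Sum.inr (Fin.last j)))⁻¹ •
        (∑ i, c (Sum.inl i) • v i + ∑ i : Fin j, c (Sum.inr i.castSucc) • w i) := by
      have h1 : c (Sum.inr (Fin.last j)) • u =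
          -(∑ i, c (Sum.inl i) • v i + ∑ i : Fin j, c (Sum.inr i.castSucc) • w i) := by
        rw [eq_neg_iff_add_eq_zero, add_comm]; exact hc
      rw [neg_smul, ← smul_neg, ← h1, smul_smul, inv_mul_cancel₀ hne, one_smul]
    rw [hu_eq]
    refine smul_mem _ _ (add_mem (sum_mem fun i _ ↦ smul_mem _ _ (subset_span ⟨Sum.inl i, rfl⟩))
      (sum_mem fun i _ ↦ smul_mem _ _ (subset_span ⟨Sum.inr i, rfl⟩)))
  rw [hlast, zero_smul, add_zero] at hc
  -- the remaining coefficients vanish by the hypothesis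
  have h0 := Fintype.linearIndependent_iff.1 h (Sum.elim (fun i ↦ c (Sum.inl i))
    (fun i : Fin j ↦ c (Sum.inr i.castSucc))) (by
      rw [Fintype.sum_sum_type]
      simpa using hc)
  rintro (i | i)
  · exact h0 (Sum.inl i)
  · refine Fin.lastCases hlast (fun i ↦ ?_) i
    exact h0 (Sum.inr i)

/-- **Extension of a linearly independent family to a basis of a finite-dimensional subspace**,
with the new vectors indexed by `Fin l`. [folklore] -/
theorem exists_linearIndependent_extension [FiniteDimensional F M] (W : Submodule F M)
    {ι : Type*} [Fintype ι] {v : ι → M} (hv : ∀ i, v i ∈ W) (hli : LinearIndependent F v) :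
    ∃ (l : ℕ) (w : Fin l → M), (∀ j, w j ∈ W) ∧ LinearIndependent F (Sum.elim v w) ∧
      span F (Set.range (Sum.elim v w)) = W := by
  classical
  -- independent extensions of every admissible length
  have step : ∀ j : ℕ, Fintype.card ι + j ≤ finrank F W →
      ∃ w : Fin j → M, (∀ i, w i ∈ W) ∧ LinearIndependent F (Sum.elim v w) := by
    intro j
    induction j with
    | zero =>
      intro _
      refine ⟨Fin.elim0, fun i ↦ i.elim0, ?_⟩
      exact hli.sum_type (linearIndependent_empty_type) (by simp)
    | succ j ih =>
      intro hj
      obtain ⟨w, hw, hind⟩ := ih (by omega)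
      -- the span is still a proper subspace of `W`
      have hle : span F (Set.range (Sum.elim v w)) ≤ W := by
        rw [span_le]
        rintro _ ⟨i | i, rfl⟩
        · exact hv i
        · exact hw i
      have hne : span F (Set.range (Sum.elim v w)) ≠ W := by
        intro heq
        have h1 := finrank_span_eq_card hind
        rw [heq, Fintype.card_sum, Fintype.card_fin] at h1
        omega
      obtain ⟨u, huW, hu⟩ := SetLike.exists_of_lt (lt_of_le_of_ne hle hne)
      refine ⟨Fin.snoc w u, fun i ↦ Fin.lastCases (by simpa using huW)
        (fun i ↦ by simpa using hw i) i, linearIndependent_sum_snoc hind hu⟩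
  -- the longest one spans `W`
  have hcard : Fintype.card ι ≤ finrank F W := by
    have h1 := finrank_span_eq_card hli
    have h2 : span F (Set.range v) ≤ W := span_le.2 (by rintro _ ⟨i, rfl⟩; exact hv i)
    have := Submodule.finrank_mono h2
    omega
  obtain ⟨w, hw, hind⟩ := step (finrank F W - Fintype.card ι) (by omega)
  refine ⟨_, w, hw, hind, ?_⟩
  have hmem : ∀ i, Sum.elim v w i ∈ W := by
    rintro (i | i)
    · exact hv i
    · exact hw i
  set f' : ι ⊕ Fin (finrank F W - Fintype.card ι) → W := fun i ↦ ⟨Sum.elim v w i, hmem i⟩ with hf'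
  have hli' : LinearIndependent F f' := LinearIndependent.of_comp W.subtype (by exact hind)
  have hspan' : span F (Set.range f') = ⊤ :=
    hli'.span_eq_top_of_card_eq_finrank' (by rw [Fintype.card_sum, Fintype.card_fin]; omega)
  have h2 := congrArg (Submodule.map W.subtype) hspan'
  rw [Submodule.map_span, Submodule.map_top, Submodule.range_subtype, ← Set.range_comp] at h2
  exact h2

end Extension

variable {p} in
/-- **Roy–Waldschmidt, Lemme 4.4.** If `x₁, …, x_k ∈ V ∩ 𝒪ⁿ` have linearly independent
reductions `x̄₁, …, x̄_k`, then `{x₁, …, x_k}` can be completed to a regular basis of `V`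
(complete `{x̄ᵢ}` to a basis of `V̄` and lift the new vectors to `V ∩ 𝒪ⁿ`).
[cite: RoyWaldschmidt1997ENS, Lemme 4.4, p. 774] -/
theorem lemme_4_4 {V : Submodule K (n → K)} {x : r → n → p.toValuationSubring}
    (hx : ∀ i, x i ∈ integralPoints p V)
    (hli : LinearIndependent p.residueField fun i ↦ redVec p (x i)) :
    ∃ (l : ℕ) (y : Fin l → n → p.toValuationSubring), IsRegularBasis p V (Sum.elim x y) := by
  classical
  obtain ⟨l, w, hw, hind, hspan⟩ := exists_linearIndependent_extension (reduction p V)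
    (fun i ↦ redVec_mem_reduction p (hx i)) hli
  -- lift the new vectors to `V ∩ 𝒪ⁿ`
  have hlift : ∀ j, ∃ z ∈ integralPoints p V, redVec p z = w j :=
    fun j ↦ (mem_reduction_iff p).1 (hw j)
  choose y hy hyred using hlift
  have hcomb : (fun i ↦ redVec p (Sum.elim x y i)) = Sum.elim (fun i ↦ redVec p (x i)) w := by
    funext i
    rcases i with i | j
    · rfl
    · exact hyred j
  refine ⟨l, y, ?_, ?_, ?_⟩
  · rintro (i | j)
    · exact hx i
    · exact hy j
  · rw [hcomb]; exact hind
  · rw [hcomb]; exact hspan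

variable {p} in
/-- Lemme 4.4 with the new vectors indexed by any type of the right cardinality.
[cite: RoyWaldschmidt1997ENS, Lemme 4.4, p. 774] -/
theorem lemme_4_4_of_card_eq {V : Submodule K (n → K)} {x : r → n → p.toValuationSubring}
    (hx : ∀ i, x i ∈ integralPoints p V)
    (hli : LinearIndependent p.residueField fun i ↦ redVec p (x i))
    {r' : Type*} [Fintype r'] (hr' : Fintype.card r + Fintype.card r' = finrank K V) :
    ∃ y : r' → n → p.toValuationSubring, IsRegularBasis p V (Sum.elim x y) := by
  obtain ⟨l, y, hy⟩ := lemme_4_4 hx hli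
  have hl : Fintype.card r' = Fintype.card (Fin l) := by
    have := hy.card_eq
    rw [Fintype.card_sum, Fintype.card_fin] at this
    rw [Fintype.card_fin]; omega
  obtain ⟨e⟩ : Nonempty (r' ≃ Fin l) := Fintype.card_eq.1 hl
  refine ⟨y ∘ e, ?_⟩
  have heq : Sum.elim x (y ∘ e) = Sum.elim x y ∘ Equiv.sumCongr (Equiv.refl r) e := by
    funext i; rcases i with i | i <;> rfl
  rw [heq]
  exact hy.comp_equiv _

end RoyWaldschmidt1997

end Literature.NumberTheory.Transcendental
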